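import Literature.Topology.FourManifolds.SPC4HandlesNormalFormProofs
import Literature.Topology.FourManifolds.RegularLevelSplitting
import Literature.Topology.FourManifolds.Trisections
import HarnessLib

/-!
# One `0`-handle: normalising the handle counts of the sectors and handlebodies of a trisection

Topic `Literature/Topology/FourManifolds`; infrastructure for the fact seat
`provefact-Literature.Topology.FourManifolds.exists_isBalancedGKTrisection` (Gay–Kirby 2016,
Thm. 4, existence of trisections).  Everything in this file is **proved**; no definitions, no
named facts.

Clauses (ii) and (iii) of `Literature.Topology.FourManifolds.IsGKTrisection` ask for handle
decompositions with **exactly one** handle of index `0` (`handleCount 1 k` for the sectors,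
`handleCount 1 g` for the three handlebodies `H_{ij}`), i.e. for adapted Morse functions with a
single minimum.  The Morse functions that a Morse-theoretic construction of Gay–Kirby's
trisection (§4, Lemma 14: `X₁ = {f ≤ 3/2}`, `X₂ = [0, ε] × H₁₂ ∪ 2`-handles, `X₃` the rest,
`H₁₂ ∪ H₃₁` a Heegaard splitting of `f⁻¹(3/2)` adapted to the attaching link) naturally
produces have in general *several* critical points of index `0` and otherwise only critical
points of index `1`.  Gay–Kirby dispose of this silently ("`X₁` and `X₃` are both diffeomorphic
to `♮ᵏ(S¹ × B³)`", "`H₃₁`, `H₁₂` are genus `g` handlebodies", proof of Lemma 14); the printed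
justification is Milnor's cancellation of surplus `0`-handles against `1`-handles on a connected
manifold (*Lectures on the h-cobordism theorem* (1965), Thm. 8.1 Index 0; Juhász (2023), proof
of Thm. 2.7, Step 1), which the tree has as the theorem
`Literature.Topology.FourManifolds.exists_isMorseAdapted_ncard_criticalSetOfIndex_zero_add_one_eq_holds`
(`SPC4HandlesNormalFormProofs.lean`).  This file packages that theorem in the form the
trisection seat consumes:

* `exists_isMorseAdapted_ncard_zero_eq_one_ncard_one_add` — iterating the cancellation step
  while **keeping track of the `1`-handles**: `r + 1` minima and `c₁` saddles become one minimum
  and `c₁ - r` saddles (the tree's iterations `HandlebodyBall.exists_isMorseAdapted_ncard_zero_eq_one`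
  and `exists_isMorseAdapted_ncard_zero_eq_one_of_cancel'` discard the count of index `1`);
* `hasHandleDecomposition_handleCount_one_of_two_le` — **a compact connected manifold with a
  handle decomposition into `c₀` handles of index `0`, `c₁` of index `1` and none of higher
  index has one into one `0`-handle and `g` `1`-handles, `g + c₀ = c₁ + 1`**; with the
  inequality `c₀ ≤ c₁ + 1` (`HasHandleDecomposition.apply_zero_le_apply_one_add_one`) and the
  existential form (`HasHandleDecomposition.exists_handleCount_one`);
* `RegularSublevel.hasHandleDecomposition_handleCount_one` and
  `RegularSublevel.hasHandleDecomposition_handleCount_one_superlevel` — the same for the regular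
  sublevel set `{f ≤ a}` (resp. superlevel set `{a ≤ f}`) of a Morse function on a closed
  manifold all of whose critical points below (resp. above) `a` have index `≤ 1` (resp.
  `≥ dim - 1`): the form in which the handlebodies `H₁₂ = {φ ≤ b}`, `H₃₁ = {b ≤ φ}` of a
  Heegaard function `φ` on the `3`-manifold `f⁻¹(3/2)` that is ordered but not self-indexing
  (several minima and maxima) enter Lemma 14.

## References

* D. Gay, R. Kirby, *Trisecting 4-manifolds*, Geom. Topol. 20 (2016) 3097–3132
  (arXiv:1205.1565), §4, Lemma 14 and its proof. [GayKirby2016]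
* J. Milnor, *Lectures on the h-cobordism theorem* (1965), Thm. 8.1 (Index 0) and its proof
  (PDF p. 54); *Morse theory* (1963), Thms. 3.1–3.2. [MilnorHCobordism1965] [Milnor1963]
* A. Juhász, *Differential and Low-Dimensional Topology* (2023), proof of Thm. 2.7, Step 1;
  §3.5. [Juhasz2023]
-/

open scoped Manifold ContDiff Topology
open Set Function

noncomputable section

universe u

namespace Literature.Topology.FourManifolds

/-! ### Iterating the cancellation step, with the count of `1`-handles -/

section Abstract

variable {n : ℕ} {W : Type u} [TopologicalSpace W] [T2Space W] [SecondCountableTopology W]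
  [CompactSpace W] [ConnectedSpace W] [ChartedSpace (EuclideanHalfSpace (n + 1)) W]
  [IsManifold (𝓡∂ (n + 1)) ∞ W]

/-- **Cancelling surplus `0`-handles, keeping track of the `1`-handles** (Milnor 1965, Thm. 8.1
Index 0, "a finite induction"; Juhász 2023, proof of Thm. 2.7, Step 1): on a compact connected
manifold with boundary, an adapted Morse function with `r + 1` critical points of index `0`,
`c₁` of index `1` and none of index `≥ 2` can be replaced by one with a single critical point
of index `0`, `c₁ - r` of index `1` (stated additively) and none of index `≥ 2` — by the
tree's cancellation step `exists_isMorseAdapted_ncard_criticalSetOfIndex_zero_add_one_eq_holds`,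
which removes one critical point of index `0` and one of index `1` at a time.
[cite: MilnorHCobordism1965, Thm. 8.1 Index 0 and its proof (PDF p. 54)]
[cite: Juhasz2023, proof of Thm. 2.7, Step 1] -/
theorem exists_isMorseAdapted_ncard_zero_eq_one_ncard_one_add :
    ∀ (r : ℕ) (f : W → ℝ), IsMorseAdapted (𝓡∂ (n + 1)) f →
      (criticalSetOfIndex (𝓡∂ (n + 1)) f 0).ncard = r + 1 →
      (∀ k, 2 ≤ k → (criticalSetOfIndex (𝓡∂ (n + 1)) f k).ncard = 0) →
      ∃ g : W → ℝ, IsMorseAdapted (𝓡∂ (n + 1)) g ∧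
        (criticalSetOfIndex (𝓡∂ (n + 1)) g 0).ncard = 1 ∧
        (criticalSetOfIndex (𝓡∂ (n + 1)) g 1).ncard + r =
          (criticalSetOfIndex (𝓡∂ (n + 1)) f 1).ncard ∧
        ∀ k, 2 ≤ k → (criticalSetOfIndex (𝓡∂ (n + 1)) g k).ncard = 0 := by
  intro r
  induction r with
  | zero =>
    intro f hf h0 h2
    exact ⟨f, hf, h0, by simp, h2⟩
  | succ r ih =>
    intro f hf h0 h2
    obtain ⟨g₁, hg₁, h0₁, h1₁, hk₁⟩ :=
      exists_isMorseAdapted_ncard_criticalSetOfIndex_zero_add_one_eq_holds n W f hf (by omega)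
    obtain ⟨g, hg, h0g, h1g, hkg⟩ :=
      ih g₁ hg₁ (by omega) fun k hk => (hk₁ k hk).trans (h2 k hk)
    exact ⟨g, hg, h0g, by omega, hkg⟩

/-- **One `0`-handle.**  A compact connected manifold with a handle decomposition
(`Literature.Topology.FourManifolds.HasHandleDecomposition`: an adapted Morse function with
prescribed numbers of critical points of each index) into `c 0` handles of index `0`, `c 1` of
index `1` and none of index `≥ 2` has a handle decomposition with one `0`-handle and `g`
`1`-handles whenever `g + c 0 = c 1 + 1` (Milnor 1965, Thm. 8.1 Index 0: the `c 0 - 1` surplus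
minima cancel against as many `1`-handles; `c 0 ≥ 1` because an adapted Morse function on a
nonempty compact manifold attains its minimum at an interior critical point of index `0`,
`IsMorseAdapted.exists_mem_criticalSetOfIndex_zero`).  This is the normal form asked for by
clauses (ii) (`handleCount 1 k`) and (iii) (`handleCount 1 g`) of
`Literature.Topology.FourManifolds.IsGKTrisection`, and the step "`X₁`, `X₃ ≅ ♮ᵏ(S¹ × B³)`;
`H₁₂`, `H₃₁` are genus-`g` handlebodies" of Gay–Kirby's proof of Lemma 14.
[cite: MilnorHCobordism1965, Thm. 8.1 Index 0 and its proof (PDF p. 54)]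
[cite: GayKirby2016, §4, proof of Lemma 14] -/
theorem hasHandleDecomposition_handleCount_one_of_two_le [Nonempty W] {c : ℕ → ℕ}
    (h : HasHandleDecomposition n W c) (hc : ∀ k, 2 ≤ k → c k = 0) {g : ℕ}
    (hg : g + c 0 = c 1 + 1) : HasHandleDecomposition n W (handleCount 1 g) := by
  obtain ⟨f, hf, hcount⟩ := h
  have hfin : ∀ k, (criticalSetOfIndex (𝓡∂ (n + 1)) f k).Finite := fun k =>
    (IsMorse.finite_criticalSet_holds hf.isMorse).subset (criticalSetOfIndex_subset _ f k)
  obtain ⟨p₀, hp₀⟩ := hf.exists_mem_criticalSetOfIndex_zero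
  have hpos : 0 < c 0 := by
    rw [← hcount 0]
    exact (Set.ncard_pos (hfin 0)).2 ⟨p₀, hp₀⟩
  obtain ⟨r, hr⟩ : ∃ r, c 0 = r + 1 := ⟨c 0 - 1, by omega⟩
  obtain ⟨g', hg', h0, h1, h2⟩ := exists_isMorseAdapted_ncard_zero_eq_one_ncard_one_add r f hf
    (by rw [hcount 0, hr]) (fun k hk => by rw [hcount k, hc k hk])
  refine ⟨g', hg', fun k => ?_⟩
  rcases Nat.lt_or_ge k 2 with hk | hk
  · interval_cases k
    · simpa using h0
    · rw [hcount 1] at h1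
      change _ = g
      omega
  · rw [h2 k hk, handleCount_of_two_le _ _ hk]

/-- On a compact connected manifold, a handle decomposition into `0`- and `1`-handles only has
at most one more `0`-handle than `1`-handles: `c 0 ≤ c 1 + 1` (the surplus minima cancel
against distinct `1`-handles, Milnor 1965, Thm. 8.1 Index 0; for `W = ∅` both sides are read
off the empty critical set). [cite: MilnorHCobordism1965, Thm. 8.1 Index 0 and its proof (PDF p. 54)] -/
theorem HasHandleDecomposition.apply_zero_le_apply_one_add_one {c : ℕ → ℕ}
    (h : HasHandleDecomposition n W c) (hc : ∀ k, 2 ≤ k → c k = 0) : c 0 ≤ c 1 + 1 := by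
  obtain ⟨f, hf, hcount⟩ := h
  rcases isEmpty_or_nonempty W with hW | hW
  · rw [← hcount 0, Set.eq_empty_of_isEmpty (criticalSetOfIndex (𝓡∂ (n + 1)) f 0), ncard_empty]
    exact Nat.zero_le _
  · have hfin : ∀ k, (criticalSetOfIndex (𝓡∂ (n + 1)) f k).Finite := fun k =>
      (IsMorse.finite_criticalSet_holds hf.isMorse).subset (criticalSetOfIndex_subset _ f k)
    obtain ⟨p₀, hp₀⟩ := hf.exists_mem_criticalSetOfIndex_zero
    have hpos : 0 < c 0 := by
      rw [← hcount 0]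
      exact (Set.ncard_pos (hfin 0)).2 ⟨p₀, hp₀⟩
    obtain ⟨r, hr⟩ : ∃ r, c 0 = r + 1 := ⟨c 0 - 1, by omega⟩
    obtain ⟨g', -, -, h1, -⟩ := exists_isMorseAdapted_ncard_zero_eq_one_ncard_one_add r f hf
      (by rw [hcount 0, hr]) (fun k hk => by rw [hcount k, hc k hk])
    rw [hcount 1] at h1
    omega

/-- **One `0`-handle, existential form**: a compact connected nonempty manifold with a handle
decomposition into `c 0` handles of index `0`, `c 1` of index `1` and no others has one with a
single `0`-handle and `g = c 1 + 1 - c 0` `1`-handles (Milnor 1965, Thm. 8.1 Index 0).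
[cite: MilnorHCobordism1965, Thm. 8.1 Index 0 and its proof (PDF p. 54)] -/
theorem HasHandleDecomposition.exists_handleCount_one [Nonempty W] {c : ℕ → ℕ}
    (h : HasHandleDecomposition n W c) (hc : ∀ k, 2 ≤ k → c k = 0) :
    ∃ g : ℕ, g + c 0 = c 1 + 1 ∧ HasHandleDecomposition n W (handleCount 1 g) :=
  ⟨c 1 + 1 - c 0, by have := h.apply_zero_le_apply_one_add_one hc; omega,
    hasHandleDecomposition_handleCount_one_of_two_le h hc
      (by have := h.apply_zero_le_apply_one_add_one hc; omega)⟩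

end Abstract

/-! ### Regular sublevel and superlevel sets of Morse functions on closed manifolds -/

section Sublevel

variable {k : ℕ} {M : Type u} [TopologicalSpace M] [T2Space M] [SecondCountableTopology M]
  [CompactSpace M] [ChartedSpace (EuclideanSpace ℝ (Fin (k + 1))) M] [IsManifold (𝓡 (k + 1)) ∞ M]
  {f : M → ℝ} {a : ℝ}

/-- **The sublevel set `{f ≤ a}` below the `2`-handles has one `0`-handle and `g` `1`-handles,
`g + c₀ = c₁ + 1`.**  Let `f` be a Morse function on a closed manifold `M`, `a` a level through
no critical point, such that every critical point `z` with `f z ≤ a` has index `≤ 1`, and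
suppose the regular sublevel set `Mᵃ = {f ≤ a}` (`Literature.Topology.FourManifolds.RegularSublevel`,
Milnor 1963, Thm. 3.1) is nonempty and connected.  Then `Mᵃ` has a handle decomposition with
one `0`-handle and `g` `1`-handles, where `g + c₀ = c₁ + 1` and `cᵢ` is the number of critical
points of `f` of index `i` below `a`: the adapted Morse function `f|Mᵃ + (1 - a)` has `cᵢ`
critical points of index `i` (`RegularSublevel.hasHandleDecomposition`, Milnor 1963,
Thms. 3.1–3.2) and the surplus minima cancel (Milnor 1965, Thm. 8.1 Index 0).  For a
self-indexing `f` with one minimum and `a = 3/2` this is the handlebody `{f ≤ 3/2}` of the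
tree's Heegaard splitting (`isHandlebody_regularSublevel_three_halves`); the present form serves
Heegaard functions that are ordered but have several minima.
[cite: Milnor1963, Thms. 3.1–3.2] [cite: MilnorHCobordism1965, Thm. 8.1 Index 0 and its proof (PDF p. 54)] -/
theorem RegularSublevel.hasHandleDecomposition_handleCount_one (hf : IsMorse (𝓡 (k + 1)) f)
    (h : IsRegularLevel (𝓡 (k + 1)) f a) [ConnectedSpace (RegularSublevel h)]
    [Nonempty (RegularSublevel h)]
    (hidx : ∀ z, IsMCriticalPt (𝓡 (k + 1)) f z → f z ≤ a → morseIndex (𝓡 (k + 1)) f z ≤ 1)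
    {g : ℕ} (hg : g + (criticalSetOfIndex (𝓡 (k + 1)) f 0 ∩ f ⁻¹' Iic a).ncard =
      (criticalSetOfIndex (𝓡 (k + 1)) f 1 ∩ f ⁻¹' Iic a).ncard + 1) :
    HasHandleDecomposition k (RegularSublevel h) (handleCount 1 g) := by
  refine hasHandleDecomposition_handleCount_one_of_two_le
    (RegularSublevel.hasHandleDecomposition hf h) (fun i hi => ?_) hg
  have hempty : criticalSetOfIndex (𝓡 (k + 1)) f i ∩ f ⁻¹' Iic a = ∅ := by
    refine Set.eq_empty_of_forall_notMem fun z hz => ?_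
    obtain ⟨⟨hzc, hzi⟩, hza⟩ := hz
    have := hidx z hzc hza
    omega
  change (criticalSetOfIndex (𝓡 (k + 1)) f i ∩ f ⁻¹' Iic a).ncard = 0
  rw [hempty, ncard_empty]

/-- **The superlevel set `{a ≤ f}` above the `(dim - 2)`-handles has one `0`-handle and `g`
`1`-handles, `g + c_{dim} = c_{dim - 1} + 1`** (the previous theorem for the turned-about
function `a - f`, whose critical points of index `i` are those of `f` of index `dim - i`,
`Literature.Topology.FourManifolds.IsMorse.criticalSetOfIndex_const_sub`; Milnor 1965, proof of
Thm. 9.1, "turning the triad about"): for a Morse function `f` on a closed `(k+1)`-manifold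
and a level `a` through no critical point such that every critical point `z` with `a ≤ f z`
has index `≥ k`, if the regular superlevel set `M_a = {a ≤ f}` (`RegularSuperlevel`) is
nonempty and connected then it has a handle decomposition with one `0`-handle and `g`
`1`-handles, `g + c_{k+1} = c_k + 1`, `cᵢ` the number of critical points of `f` of index `i`
above `a`.  For a self-indexing `f` on a closed `3`-manifold with one maximum and `a = 3/2`
this is the upper handlebody `{3/2 ≤ f}` of the tree's Heegaard splitting
(`isHandlebody_regularSuperlevel_three_halves`).
[cite: MilnorHCobordism1965, proof of Thm. 9.1 (turning about); Thm. 8.1 Index 0]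
[cite: Milnor1963, Thms. 3.1–3.2] -/
theorem RegularSublevel.hasHandleDecomposition_handleCount_one_superlevel
    (hf : IsMorse (𝓡 (k + 1)) f) (h : IsRegularLevel (𝓡 (k + 1)) f a)
    [ConnectedSpace (RegularSuperlevel h)] [Nonempty (RegularSuperlevel h)]
    (hidx : ∀ z, IsMCriticalPt (𝓡 (k + 1)) f z → a ≤ f z → k ≤ morseIndex (𝓡 (k + 1)) f z)
    {g : ℕ} (hg : g + (criticalSetOfIndex (𝓡 (k + 1)) f (k + 1) ∩ f ⁻¹' Ici a).ncard =
      (criticalSetOfIndex (𝓡 (k + 1)) f k ∩ f ⁻¹' Ici a).ncard + 1) :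
    HasHandleDecomposition k (RegularSuperlevel h) (handleCount 1 g) := by
  have hf' : IsMorse (𝓡 (k + 1)) (fun y => a - f y) := hf.const_sub a
  have hpre : (fun y => a - f y) ⁻¹' Iic (0 : ℝ) = f ⁻¹' Ici a := by
    ext z
    simp only [mem_preimage, mem_Iic, mem_Ici, sub_nonpos]
  have hrank : Module.finrank ℝ (EuclideanSpace ℝ (Fin (k + 1))) = k + 1 :=
    finrank_euclideanSpace_fin
  have hset : ∀ {i : ℕ}, i ≤ k + 1 →
      criticalSetOfIndex (𝓡 (k + 1)) (fun y => a - f y) i ∩ (fun y => a - f y) ⁻¹' Iic 0 =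
        criticalSetOfIndex (𝓡 (k + 1)) f (k + 1 - i) ∩ f ⁻¹' Ici a := by
    intro i hi
    rw [hf.criticalSetOfIndex_const_sub a (by rw [hrank]; exact hi), hrank, hpre]
  refine RegularSublevel.hasHandleDecomposition_handleCount_one hf' h.const_sub
    (fun z hz hza => ?_) (g := g) ?_
  · have hd : MDifferentiableAt (𝓡 (k + 1)) 𝓘(ℝ, ℝ) f z :=
      hf.contMDiff.mdifferentiableAt (by simp)
    have hz' : IsMCriticalPt (𝓡 (k + 1)) f z := (isMCriticalPt_const_sub_iff a hd).1 hz
    have hsum := hf.morseIndex_const_sub_add a hz'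
    rw [hrank] at hsum
    have := hidx z hz' (sub_nonpos.1 hza)
    omega
  · rw [hset (Nat.zero_le _), hset (by omega), Nat.sub_zero, Nat.add_sub_cancel]
    exact hg

end Sublevel

end Literature.Topology.FourManifolds

end
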